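import Mathlib.Analysis.SpecialFunctions.Pow.Asymptotics
import Mathlib.Data.Nat.Choose.Cast
import Mathlib.Data.Sym.Card
import Literature.Computability.Complexity.Rossman2008
import HarnessLib

/-!
# Rossman 2008, Theorem 1.2 from Theorem 1.1: `k`-clique needs constant-depth size `ω(n^{k/4})`

B. Rossman, *On the constant-depth complexity of k-clique*, STOC 2008 [Rossman2008], §5, proof of
Theorem 1.2 (p. 9 of the author's copy): "Let `C = (C_n)` be a sequence of circuits of depth
`O(1)` and size `O(n^t)` for `t = k/4 (> 1/2)`. Let `α = 1/(2t-1)` and note that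
`α = 2/(k-2) > 2/(k-1) = thres(K_k)`. For random `G ∈ ER(n, n^{-α})` and `A ∈ C([n], k)`,
Theorem 1.1 tells us that `C(G) = C(G ∪ K_A)` asymptotically almost surely. By Lemma 2.1(1), `G`
a.a.s. contains no `k`-clique as `α > thres(K_k)`. On the other hand, `G ∪ K_A` contains a
`k`-clique (with probability 1). It follows that `C` does not define the property of containing a
`k`-clique (for sufficiently large `n`)."

This file PROVES that deduction over the finite-sum model of `G(n,q)` of `Rossman2008.lean`,
so that Theorem 1.2 is a theorem relative to the single named fact `rossman2008_thm11`
(`rossman2008_thm12_of_thm11`), in the uniform reading of "requires size `ω(n^{k/4})`": for every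
`k ≥ 3`, depth `d` and constant `c₀`, for all large `n`, every `{¬,∧,∨}`-circuit of `acDepth ≤ d`
computing `CLIQUE(n,k)` has more than `c₀ · n^{k/4}` gates. ("Lemma 2.1(1)" — no `k`-clique
a.a.s. strictly below the threshold — is replaced by the first-moment bound
`Pr[ω(G(n,q)) ≥ k] ≤ C(n,k) q^{C(k,2)}`, which is all the proof uses.)

Contents (all proved, no definitions):
* the `G(n,q)` calculus on edge vectors: `card_edgeSet_top_fin` (`|E(K_n)| = C(n,2)`),
  `gnpWeight_eq_prod`, `sum_boolVec_prod` (product–sum exchange), `sum_gnpWeight` (total mass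
  `1`), `sum_gnpWeight_filter_forall` (`Pr[S ⊆ E(G)] = q^{|S|}`), `card_filter_cliqueVec`
  (`K_A` has `C(|A|,2)` edges), `gnpProb_clique_le` (first moment / union bound);
* planting: `cliqueFn_plantClique` (`G ∪ K_A` has a `k`-clique), `plantFlipProb_cliqueFn`
  (`Pr[CLIQUE(G) ≠ CLIQUE(G ∪ K_A)] = Pr[ω(G) < k]`);
* the threshold arithmetic `k - (2/(k-2)) C(k,2) = -k/(k-2)` and
  `C(n,k) (n^{-2/(k-2)})^{C(k,2)} → 0`;
* `rossman2008_thm12_of_thm11`.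

Scope remark (why `3 ≤ k`): the paper says "for every constant `k`" and "the bound is certainly
trivial for `k ≤ 3`, so we assume `k ≥ 4`"; in the gate-count measure the statement is FALSE for
`k = 2` (one `∨`-gate of fan-in `C(n,2)` computes `CLIQUE(n,2)`, size `1 ≯ c₀ n^{1/2}`) and
degenerate for `k ≤ 1`, while `k = 3` is covered by Theorem 1.1 with `t = 3/4`, `α = 2`
exactly as `k ≥ 4` is. We therefore state it for `k ≥ 3`.

## References

* [Rossman2008] B. Rossman, On the constant-depth complexity of k-clique, STOC 2008, Thm. 1.2 and
  its proof in §5; Lemma 2.1 (Janson–Łuczak–Ruciński) for the clique count.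
-/

noncomputable section

namespace Literature.Computability.Complexity

open Finset Filter
open scoped _root_.Topology

variable {n : ℕ}

/-! ### The `G(n, q)` calculus on edge vectors -/

/-- `|E(K_n)| = C(n,2)`: the complete graph on `Fin n` has `n choose 2` edges. [folklore] -/
theorem card_edgeSet_top_fin (n : ℕ) :
    Fintype.card ((⊤ : SimpleGraph (Fin n)).edgeSet) = n.choose 2 := by
  have h := SimpleGraph.card_edgeFinset_top_eq_card_choose_two (V := Fin n)
  rw [SimpleGraph.edgeFinset_card, Fintype.card_fin] at h
  exact h

/-- The number of absent edges is `C(n,2) - e(x)`. [folklore] -/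
theorem card_filter_eq_false (x : (⊤ : SimpleGraph (Fin n)).edgeSet → Bool) :
    #(univ.filter fun e => ¬ x e = true) = n.choose 2 - edgeCount x := by
  have h := card_filter_add_card_filter_not (s := (univ : Finset _))
    (fun e : (⊤ : SimpleGraph (Fin n)).edgeSet => x e = true)
  rw [card_univ, card_edgeSet_top_fin] at h
  rw [edgeCount]
  omega

/-- Product form of the `G(n,q)` weight: `Pr[G(n,q) = x] = ∏_e (q if e ∈ x else 1 - q)`
(independent edges). [folklore] -/
theorem gnpWeight_eq_prod (q : ℝ) (x : (⊤ : SimpleGraph (Fin n)).edgeSet → Bool) :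
    gnpWeight n q x = ∏ e, if x e = true then q else 1 - q := by
  rw [prod_ite, prod_const, prod_const, gnpWeight, card_filter_eq_false, edgeCount]

/-- Product–sum exchange over Boolean vectors: `Σ_x ∏_e φ_e(x_e) = ∏_e (φ_e(1) + φ_e(0))`.
[folklore] -/
theorem sum_boolVec_prod {ι : Type*} [Fintype ι] [DecidableEq ι] (φ : ι → Bool → ℝ) :
    ∑ x : ι → Bool, ∏ e, φ e (x e) = ∏ e, (φ e true + φ e false) := by
  rw [← Fintype.piFinset_univ, ← Finset.prod_univ_sum]
  simp

/-- Total mass: `Σ_x Pr[G(n,q) = x] = 1`. [folklore] -/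
theorem sum_gnpWeight (q : ℝ) :
    ∑ x : (⊤ : SimpleGraph (Fin n)).edgeSet → Bool, gnpWeight n q x = 1 := by
  classical
  simp_rw [gnpWeight_eq_prod]
  rw [sum_boolVec_prod (fun _ b => if b = true then q else 1 - q)]
  simp

/-- `Pr[S ⊆ E(G(n,q))] = q^{|S|}`: the mass of the edge vectors switching on every edge of a fixed
edge set `S`. [folklore] -/
theorem sum_gnpWeight_filter_forall (q : ℝ) (S : Finset ((⊤ : SimpleGraph (Fin n)).edgeSet)) :
    ∑ x ∈ univ.filter (fun x : (⊤ : SimpleGraph (Fin n)).edgeSet → Bool => ∀ e ∈ S, x e = true),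
      gnpWeight n q x = q ^ #S := by
  classical
  rw [sum_filter]
  have key : ∀ x : (⊤ : SimpleGraph (Fin n)).edgeSet → Bool,
      (if ∀ e ∈ S, x e = true then gnpWeight n q x else 0) =
        ∏ e, ((if x e = true then q else 1 - q) *
          (if e ∈ S then (if x e = true then 1 else 0) else 1)) := by
    intro x
    rw [prod_mul_distrib, ← gnpWeight_eq_prod]
    split_ifs with h
    · rw [prod_eq_one, mul_one]
      intro e _
      by_cases he : e ∈ S
      · rw [if_pos he, if_pos (h e he)]
      · rw [if_neg he]
    · push Not at h
      obtain ⟨e, heS, hxe⟩ := h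
      rw [prod_eq_zero (mem_univ e), mul_zero]
      rw [if_pos heS, if_neg hxe]
  simp_rw [key]
  rw [sum_boolVec_prod (fun e b => (if b = true then q else 1 - q) *
    (if e ∈ S then (if b = true then (1 : ℝ) else 0) else 1))]
  calc _ = ∏ e : (⊤ : SimpleGraph (Fin n)).edgeSet, (if e ∈ S then q else (1 : ℝ)) :=
        prod_congr rfl fun e _ => by by_cases he : e ∈ S <;> simp [he]
    _ = q ^ #S := by rw [prod_ite_mem, univ_inter, prod_const]

/-- `K_A` has `C(|A|, 2)` edges: the edges of `K_n` with both endpoints in `A`. [folklore] -/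
theorem card_filter_cliqueVec (A : Finset (Fin n)) :
    #(univ.filter fun e : (⊤ : SimpleGraph (Fin n)).edgeSet => cliqueVec A e = true) =
      (#A).choose 2 := by
  classical
  rw [← Sym2.card_image_offDiag A]
  refine card_bij (fun e _ => (e : Sym2 (Fin n))) (fun e he => ?_) (fun e₁ _ e₂ _ h => Subtype.ext h)
    (fun z hz => ?_)
  · obtain ⟨e, he'⟩ := e
    simp only [mem_filter, mem_univ, true_and, cliqueVec, decide_eq_true_eq] at he
    induction e using Sym2.ind with
    | h u v =>
      have huv : u ≠ v := by simpa using he'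
      simp only [mem_image, mem_offDiag]
      exact ⟨(u, v), ⟨he u (Sym2.mem_mk_left u v), he v (Sym2.mem_mk_right u v), huv⟩, rfl⟩
  · simp only [mem_image, mem_offDiag] at hz
    obtain ⟨⟨a, b⟩, ⟨ha, hb, hab⟩, rfl⟩ := hz
    refine ⟨⟨s(a, b), by simpa using hab⟩, ?_, rfl⟩
    simp only [mem_filter, mem_univ, true_and, cliqueVec, decide_eq_true_eq]
    intro v hv
    rcases Sym2.mem_iff.1 hv with rfl | rfl
    · exact ha
    · exact hb

/-- A clique of the graph of `x` switches on every edge inside it. [folklore] -/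
theorem forall_cliqueVec_of_isClique {x : (⊤ : SimpleGraph (Fin n)).edgeSet → Bool}
    {A : Finset (Fin n)} (hA : (cliqueGraph x).IsClique (A : Set (Fin n))) :
    ∀ e : (⊤ : SimpleGraph (Fin n)).edgeSet, cliqueVec A e = true → x e = true := by
  rintro ⟨e, he⟩ hc
  induction e using Sym2.ind with
  | h u v =>
    have huv : u ≠ v := by simpa using he
    simp only [cliqueVec, Sym2.mem_iff, forall_eq_or_imp, forall_eq, decide_eq_true_eq] at hc
    have hadj := hA hc.1 hc.2 huv
    rw [cliqueGraph_adj] at hadj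
    obtain ⟨_, hx⟩ := hadj
    exact hx

/-- **First moment / union bound**: `Pr[ω(G(n,q)) ≥ k] ≤ C(n,k) · q^{C(k,2)}` for `0 ≤ q ≤ 1`
(Rossman 2008, Lemma 2.1(1) via Markov: the expected number of `k`-cliques is
`C(n,k) q^{C(k,2)}`). [cite: Rossman2008, Lemma 2.1 (first moment)] -/
theorem gnpProb_clique_le {q : ℝ} (hq0 : 0 ≤ q) (hq1 : q ≤ 1) (k : ℕ) :
    ∑ x ∈ univ.filter (fun x : (⊤ : SimpleGraph (Fin n)).edgeSet → Bool => cliqueFn n k x = true),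
      gnpWeight n q x ≤ (n.choose k : ℝ) * q ^ (k.choose 2) := by
  classical
  -- the indicator of "`A` is a clique of `x`" as a filter predicate
  let P : Finset (Fin n) → ((⊤ : SimpleGraph (Fin n)).edgeSet → Bool) → Prop := fun A x =>
    ∀ e ∈ univ.filter (fun e : (⊤ : SimpleGraph (Fin n)).edgeSet => cliqueVec A e = true), x e = true
  have hterm : ∀ A x, 0 ≤ (if P A x then gnpWeight n q x else 0) := fun A x => by
    split_ifs
    · exact gnpWeight_nonneg hq0 hq1 x
    · exact le_rfl
  calc ∑ x ∈ univ.filter (fun x => cliqueFn n k x = true), gnpWeight n q x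
      ≤ ∑ x ∈ univ.filter (fun x => cliqueFn n k x = true),
          ∑ A ∈ powersetCard k (univ : Finset (Fin n)), (if P A x then gnpWeight n q x else 0) := by
        refine sum_le_sum fun x hx => ?_
        rw [mem_filter, cliqueFn_eq_true_iff] at hx
        obtain ⟨s, hs⟩ := not_forall_not.1 fun h => hx.2 fun t ht => h t ht
        have hsk : s ∈ powersetCard k (univ : Finset (Fin n)) :=
          mem_powersetCard.2 ⟨subset_univ _, hs.card_eq⟩
        have hPs : P s x := fun e he => forall_cliqueVec_of_isClique hs.isClique e (mem_filter.1 he).2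
        calc gnpWeight n q x = (if P s x then gnpWeight n q x else 0) := by rw [if_pos hPs]
          _ ≤ ∑ A ∈ powersetCard k univ, (if P A x then gnpWeight n q x else 0) :=
            single_le_sum (fun A _ => hterm A x) hsk
    _ ≤ ∑ x, ∑ A ∈ powersetCard k (univ : Finset (Fin n)), (if P A x then gnpWeight n q x else 0) :=
        sum_le_sum_of_subset_of_nonneg (filter_subset _ _)
          (fun x _ _ => sum_nonneg fun A _ => hterm A x)
    _ = ∑ A ∈ powersetCard k (univ : Finset (Fin n)), ∑ x, (if P A x then gnpWeight n q x else 0) :=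
        sum_comm
    _ = ∑ A ∈ powersetCard k (univ : Finset (Fin n)), q ^ (k.choose 2) := by
        refine sum_congr rfl fun A hA => ?_
        rw [← sum_filter, sum_gnpWeight_filter_forall, card_filter_cliqueVec,
          (mem_powersetCard.1 hA).2]
    _ = (n.choose k : ℝ) * q ^ (k.choose 2) := by
        rw [sum_const, card_powersetCard, card_univ, Fintype.card_fin, nsmul_eq_mul]

/-! ### Planting a `k`-clique -/

/-- `G ∪ K_A` contains a `k`-clique when `|A| ≥ k` ("`G ∪ K_A` contains a `k`-clique (with
probability 1)"). [cite: Rossman2008, §5 (proof of Thm. 1.2)] -/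
theorem cliqueFn_plantClique {k : ℕ} {A : Finset (Fin n)} (hA : k ≤ #A)
    (x : (⊤ : SimpleGraph (Fin n)).edgeSet → Bool) : cliqueFn n k (plantClique A x) = true := by
  have hle : cliqueVec A ≤ plantClique A x := fun e => by
    simp only [plantClique]
    exact Bool.right_le_or _ _
  have hmono := cliqueFn_monotone_holds n k hle
  rw [cliqueFn_cliqueVec hA] at hmono
  exact top_le_iff.1 hmono

/-- For the clique function itself the planted-clique flip probability is the probability of
having no `k`-clique: `Pr_{G,A}[CLIQUE(G) ≠ CLIQUE(G ∪ K_A)] = Pr[ω(G(n,q)) < k]` for `k ≤ n`.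
[cite: Rossman2008, §5 (proof of Thm. 1.2)] -/
theorem plantFlipProb_cliqueFn {k : ℕ} (hkn : k ≤ n) (q : ℝ) :
    plantFlipProb n k q (cliqueFn n k) =
      ∑ x ∈ univ.filter (fun x : (⊤ : SimpleGraph (Fin n)).edgeSet → Bool => cliqueFn n k x = false),
        gnpWeight n q x := by
  classical
  unfold plantFlipProb
  have hinner : ∀ A ∈ powersetCard k (univ : Finset (Fin n)),
      (∑ x : (⊤ : SimpleGraph (Fin n)).edgeSet → Bool,
        if cliqueFn n k x = cliqueFn n k (plantClique A x) then 0 else gnpWeight n q x) =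
      ∑ x ∈ univ.filter (fun x => cliqueFn n k x = false), gnpWeight n q x := by
    intro A hA
    have hAk : k ≤ #A := (mem_powersetCard.1 hA).2.ge
    rw [sum_filter]
    refine sum_congr rfl fun x _ => ?_
    rw [cliqueFn_plantClique hAk]
    cases cliqueFn n k x <;> simp
  rw [sum_congr rfl hinner, sum_const, card_powersetCard, card_univ, Fintype.card_fin,
    nsmul_eq_mul, ← mul_assoc, inv_mul_cancel₀, one_mul]
  exact_mod_cast (Nat.choose_pos hkn).ne'

/-- Complement: `Pr[ω(G) < k] = 1 - Pr[ω(G) ≥ k]`. [folklore] -/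
theorem gnpProb_cliqueFree_eq (k : ℕ) (q : ℝ) :
    ∑ x ∈ univ.filter (fun x : (⊤ : SimpleGraph (Fin n)).edgeSet → Bool => cliqueFn n k x = false),
        gnpWeight n q x =
      1 - ∑ x ∈ univ.filter (fun x : (⊤ : SimpleGraph (Fin n)).edgeSet → Bool =>
        cliqueFn n k x = true), gnpWeight n q x := by
  rw [eq_sub_iff_add_eq, ← sum_gnpWeight (n := n) q]
  rw [← sum_filter_add_sum_filter_not univ (fun x => cliqueFn n k x = false)]
  congr 1
  refine sum_congr ?_ fun _ _ => rfl
  ext x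
  simp

/-! ### The threshold arithmetic -/

/-- `C(n,k) · (n^{-2/(k-2)})^{C(k,2)} → 0` for `k ≥ 3`: below the `k`-clique threshold the expected
number of `k`-cliques vanishes (`k - (2/(k-2))·C(k,2) = -k/(k-2) < 0`).
[cite: Rossman2008, §5 (proof of Thm. 1.2: α = 2/(k-2) > thres(K_k))] -/
theorem tendsto_choose_mul_rpow_subcritical {k : ℕ} (hk : 3 ≤ k) :
    Tendsto (fun n : ℕ => (n.choose k : ℝ) * ((n : ℝ) ^ (-(2 / ((k : ℝ) - 2)))) ^ (k.choose 2))
      atTop (𝓝 0) := by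
  have hk2 : (0 : ℝ) < (k : ℝ) - 2 := by
    have : (3 : ℝ) ≤ k := by exact_mod_cast hk
    linarith
  -- the exponent
  have hexp : (k : ℝ) + -(2 / ((k : ℝ) - 2)) * (k.choose 2 : ℕ) = -((k : ℝ) / ((k : ℝ) - 2)) := by
    rw [Nat.cast_choose_two]
    field_simp
    ring
  have hneg : 0 < (k : ℝ) / ((k : ℝ) - 2) := div_pos (by positivity) hk2
  -- compare with n^{-k/(k-2)}
  have hlim : Tendsto (fun n : ℕ => (n : ℝ) ^ (-((k : ℝ) / ((k : ℝ) - 2)))) atTop (𝓝 0) :=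
    (tendsto_rpow_neg_atTop hneg).comp tendsto_natCast_atTop_atTop
  refine squeeze_zero' ?_ ?_ hlim
  · filter_upwards [eventually_ge_atTop 1] with n hn
    have hn0 : (0 : ℝ) ≤ n := Nat.cast_nonneg n
    exact mul_nonneg (Nat.cast_nonneg _) (pow_nonneg (Real.rpow_nonneg hn0 _) _)
  · filter_upwards [eventually_ge_atTop 1] with n hn
    have hn0 : (0 : ℝ) < n := by exact_mod_cast hn
    have hchoose : (n.choose k : ℝ) ≤ (n : ℝ) ^ (k : ℝ) := by
      rw [Real.rpow_natCast]
      exact_mod_cast Nat.choose_le_pow n k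
    calc (n.choose k : ℝ) * ((n : ℝ) ^ (-(2 / ((k : ℝ) - 2)))) ^ (k.choose 2)
        ≤ (n : ℝ) ^ (k : ℝ) * ((n : ℝ) ^ (-(2 / ((k : ℝ) - 2)))) ^ (k.choose 2) :=
          mul_le_mul_of_nonneg_right hchoose (pow_nonneg (Real.rpow_nonneg hn0.le _) _)
      _ = (n : ℝ) ^ (-((k : ℝ) / ((k : ℝ) - 2))) := by
          rw [← Real.rpow_mul_natCast hn0.le, ← Real.rpow_add hn0, hexp]

/-! ### Theorem 1.2 -/

/-- **Rossman 2008, Theorem 1.2** (proved from Theorem 1.1 = `rossman2008_thm11`, following §5 of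
the paper): "For every constant `k`, the `k`-clique problem on `n`-vertex graphs requires
constant-depth circuits of size `ω(n^{k/4})`." Uniform reading, for `k ≥ 3` (see the module
docstring for `k ≤ 2`): for every depth `d` and constant `c₀`, for all sufficiently large `n`,
every circuit over `{¬, ∧ₖ, ∨ₖ}` of `acDepth ≤ d` that computes `CLIQUE(n,k)` on the `C(n,2)` edge
variables has more than `c₀ · n^{k/4}` gates. Proof: with `t = k/4`, `α = 1/(2t-1) = 2/(k-2)`,
`rossman2008_thm11_uniform` makes every small circuit flip with probability `≤ 1/4` under
planting on `ER(n, n^{-α})`, whereas `CLIQUE(n,k)` flips exactly when `G` has no `k`-clique,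
which has probability `≥ 1 - C(n,k) n^{-α C(k,2)} → 1`. [cite: Rossman2008, Thm. 1.2 (proof §5)] -/
theorem rossman2008_thm12_of_thm11 (h : rossman2008_thm11) {k : ℕ} (hk : 3 ≤ k) (d : ℕ)
    (c₀ : ℝ) :
    ∀ᶠ n : ℕ in atTop, ∀ C : Circuit ((⊤ : SimpleGraph (Fin n)).edgeSet),
      C.IsOver acBasis → C.acDepth ≤ d → C.Computes (cliqueFn n k) →
        c₀ * (n : ℝ) ^ ((k : ℝ) / 4) < C.size := by
  classical
  have hk3 : (3 : ℝ) ≤ k := by exact_mod_cast hk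
  set α : ℝ := 2 / ((k : ℝ) - 2) with hαdef
  have ht : (1 : ℝ) / 2 < (k : ℝ) / 4 := by linarith
  have hα : 0 < α := div_pos two_pos (by linarith)
  have hαt : α ≤ 1 / (2 * ((k : ℝ) / 4) - 1) := by
    rw [show 2 * ((k : ℝ) / 4) - 1 = ((k : ℝ) - 2) / 2 by ring, one_div_div]
  have hunif := rossman2008_thm11_uniform h k d ((k : ℝ) / 4) α c₀ ht hα hαt
    (ε := 1 / 4) (by norm_num)
  have hsmall : ∀ᶠ n : ℕ in atTop,
      (n.choose k : ℝ) * ((n : ℝ) ^ (-α)) ^ (k.choose 2) < 1 / 4 :=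
    (tendsto_order.1 (tendsto_choose_mul_rpow_subcritical hk)).2 _ (by norm_num)
  filter_upwards [hunif, hsmall, eventually_ge_atTop k, eventually_ge_atTop 1] with n hn hsm hkn hn1
  intro C hC hd hcomp
  by_contra hsize
  push Not at hsize
  have hq0 : (0 : ℝ) ≤ (n : ℝ) ^ (-α) := Real.rpow_nonneg (Nat.cast_nonneg n) _
  have hq1 : (n : ℝ) ^ (-α) ≤ 1 :=
    Real.rpow_le_one_of_one_le_of_nonpos (by exact_mod_cast hn1) (by linarith)
  -- the flip probability of `C` is that of `CLIQUE`, i.e. the probability of no `k`-clique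
  have hflip := hn C hC hd hsize
  rw [plantFlipProb_congr hcomp, plantFlipProb_cliqueFn hkn, gnpProb_cliqueFree_eq] at hflip
  have hcl := gnpProb_clique_le (n := n) hq0 hq1 k
  linarith

end Literature.Computability.Complexity

end
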